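import Literature.NumberTheory.EllipticCurves.IwasawaOrderKernelRankProofs
import Literature.NumberTheory.EllipticCurves.IwasawaAlgebraMuAdditiveProofs
import Mathlib.LinearAlgebra.TensorProduct.RightExactness
import Mathlib.RingTheory.Finiteness.Finsupp
import HarnessLib

/-!
# Iwasawa invariants along a `Λ`-linear surjection: `0 → ker π → X → Y → 0`
# (finite generation, torsion, `μ(X) = μ(ker π) + μ(Y)`, `λ(X) = λ(ker π) + λ(Y)`)

HONEST FRAMING (BSD rank-`≤ 1` residual cell `b2b-bsdres`, home
`run/shared/lean/b2b/bsd-rank1-residual/`, unit `b2b-bsdres-eisenstein-p2`, class X2; research route,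
no claim beyond stated classes): the cell deletes the COMBINATION-SHAPED residual classes of the
rank-`≤ 1` BSD formula from PUBLISHED theorems only and TYPES the construction-shaped ones; this is
not "finishing BSD". THEOREMS ONLY (no definition, no named fact, nothing asserted). Pure algebra
over `Λ = ℤ_p⟦T⟧` (Washington §13.2), needed to move Greenberg–Vatsal's invariants across the
trivial-zero quotient `S_A(ℚ_∞)/S^{str}_A(ℚ_∞)` at a split multiplicative prime (GV pp. 14–15).

* `isTorsion_of_surjective_of_ker` — an extension of torsion modules is torsion (`Λ` a domain);
* `moduleFinite_of_surjective_of_ker` — an extension of finitely generated modules is finitely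
  generated (`Submodule.fg_of_fg_map_of_fg_inf_ker`);
* `muInvariant_eq_add_of_surjective` — `μ(X) = μ(ker π) + μ(Y)` (the tree's
  `muInvariant_add_of_shortExact_holds`);
* `lambdaInvariant_eq_add_of_surjective` — **`λ(X) = λ(ker π) + λ(Y)`** for `X` finitely generated
  and torsion: `λ = dim_{ℚ_p} ℚ_p ⊗_{ℤ_p} (−)`, `ℚ_p` is flat over `ℤ_p` so `0 → ℚ_p ⊗ ker π →
  ℚ_p ⊗ X → ℚ_p ⊗ Y → 0` stays exact (`Module.Flat.lTensor_preserves_injective_linearMap`,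
  `lTensor_exact`, `LinearMap.lTensor_surjective`), all three spaces are finite-dimensional
  (`IwasawaAlgebra.finite_baseChange_of_isTorsion`), and dimension is additive.

References: L. Washington, *Introduction to Cyclotomic Fields*, §13.2; R. Greenberg, LNM 1716 §1
(`λ = dim_{ℚ_p} X ⊗ ℚ_p`).
-/

noncomputable section

open scoped Classical TensorProduct

universe u v

namespace Summit.BirchSwinnertonDyer.Rank1Residual.X2.DualRestrictionInvariants

open Literature.NumberTheory.EllipticCurves

variable (p : ℕ) [Fact p.Prime] {X : Type u} {Y : Type v} [AddCommGroup X]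
  [Module (IwasawaAlgebra p) X] [AddCommGroup Y] [Module (IwasawaAlgebra p) Y]
  (π : X →ₗ[IwasawaAlgebra p] Y)

/-- **An extension of torsion `Λ`-modules is torsion**: if `π : X → Y` is `Λ`-linear with `ker π`
and `Y` torsion, then `X` is torsion (`Λ = ℤ_p⟦T⟧` is a domain: `a·(π x) = 0`, `b·(a x) = 0 ⇒
(ba) x = 0`; surjectivity is not needed). [folklore] -/
theorem isTorsion_of_surjective_of_ker
    (hK : Module.IsTorsion (IwasawaAlgebra p) (LinearMap.ker π))
    (hY : Module.IsTorsion (IwasawaAlgebra p) Y) : Module.IsTorsion (IwasawaAlgebra p) X := by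
  intro x
  obtain ⟨a, ha⟩ := @hY (π x)
  have hax : (a : IwasawaAlgebra p) • x ∈ LinearMap.ker π := by
    rw [LinearMap.mem_ker, map_smul]
    exact ha
  obtain ⟨b, hb⟩ := @hK ⟨_, hax⟩
  refine ⟨b * a, ?_⟩
  have hb' := congrArg Subtype.val hb
  simp only [Submonoid.smul_def, SetLike.val_smul, ZeroMemClass.coe_zero] at hb' ⊢
  rw [Submonoid.coe_mul, mul_smul]
  exact hb'

/-- **An extension of finitely generated `Λ`-modules is finitely generated**: `ker π` and `Y`
finitely generated, `π` onto ⇒ `X` finitely generated (`Submodule.fg_of_fg_map_of_fg_inf_ker` for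
`s = ⊤`). [folklore] -/
theorem moduleFinite_of_surjective_of_ker (hπ : Function.Surjective π)
    (hK : (LinearMap.ker π).FG) [Module.Finite (IwasawaAlgebra p) Y] :
    Module.Finite (IwasawaAlgebra p) X := by
  refine ⟨Submodule.fg_of_fg_map_of_fg_inf_ker π ?_ ?_⟩
  · rw [Submodule.map_top, LinearMap.range_eq_top.mpr hπ]
    exact Module.Finite.fg_top
  · rw [top_inf_eq]
    exact hK

/-- **`μ(X) = μ(ker π) + μ(Y)`** along a surjection `π : X ↠ Y` of a finitely generated torsion
`Λ`-module (the tree's `muInvariant_add_of_shortExact_holds` for `0 → ker π → X → Y → 0`).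
[cite: Washington1997, §13.2] -/
theorem muInvariant_eq_add_of_surjective [Module.Finite (IwasawaAlgebra p) X]
    (hX : Module.IsTorsion (IwasawaAlgebra p) X) (hπ : Function.Surjective π) :
    muInvariant p X = muInvariant p (LinearMap.ker π) + muInvariant p Y :=
  muInvariant_add_of_shortExact_holds p X hX (LinearMap.ker π).subtype π
    (Submodule.subtype_injective _) hπ (LinearMap.exact_subtype_ker_map π)

/-- **`λ(X) = λ(ker π) + λ(Y)`** along a surjection `π : X ↠ Y` of a finitely generated torsion
`Λ`-module: `λ(M) = dim_{ℚ_p}(ℚ_p ⊗_{ℤ_p} M)`, the sequence `0 → ℚ_p ⊗ ker π → ℚ_p ⊗ X →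
ℚ_p ⊗ Y → 0` is exact (`ℚ_p` flat over `ℤ_p`), the middle space is finite-dimensional for `X`
finitely generated torsion (`IwasawaAlgebra.finite_baseChange_of_isTorsion`), and dimension is
additive. Greenberg LNM 1716 §1: "`λ_E = rank_{ℤ_p} X = dim_{ℚ_p} X ⊗ ℚ_p`".
[cite: Washington1997, §13.2] [cite: GreenbergLNM1716, §1 p. 60] -/
theorem lambdaInvariant_eq_add_of_surjective [Module.Finite (IwasawaAlgebra p) X]
    (hX : Module.IsTorsion (IwasawaAlgebra p) X) (hπ : Function.Surjective π) :
    lambdaInvariant p X = lambdaInvariant p (LinearMap.ker π) + lambdaInvariant p Y := by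
  haveI : Module.Flat ℤ_[p] ℚ_[p] := IsLocalization.flat ℚ_[p] (nonZeroDivisors ℤ_[p])
  -- the `ℤ_p`-structures (definitionally those of `RestrictScalars ℤ_p Λ _`)
  letI iX : Module ℤ_[p] X := Module.compHom X (algebraMap ℤ_[p] (IwasawaAlgebra p))
  haveI : IsScalarTower ℤ_[p] (IwasawaAlgebra p) X := IsScalarTower.of_compHom _ _ _
  letI iY : Module ℤ_[p] Y := Module.compHom Y (algebraMap ℤ_[p] (IwasawaAlgebra p))
  haveI : IsScalarTower ℤ_[p] (IwasawaAlgebra p) Y := IsScalarTower.of_compHom _ _ _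
  letI iK : Module ℤ_[p] (LinearMap.ker π) :=
    Module.compHom (LinearMap.ker π) (algebraMap ℤ_[p] (IwasawaAlgebra p))
  haveI : IsScalarTower ℤ_[p] (IwasawaAlgebra p) (LinearMap.ker π) := IsScalarTower.of_compHom _ _ _
  change Module.finrank ℚ_[p] (ℚ_[p] ⊗[ℤ_[p]] X) =
    Module.finrank ℚ_[p] (ℚ_[p] ⊗[ℤ_[p]] (LinearMap.ker π)) + Module.finrank ℚ_[p] (ℚ_[p] ⊗[ℤ_[p]] Y)
  -- the `ℤ_p`-linear short exact sequence
  let ι : LinearMap.ker π →ₗ[ℤ_[p]] X := (LinearMap.ker π).subtype.restrictScalars ℤ_[p]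
  let π' : X →ₗ[ℤ_[p]] Y := π.restrictScalars ℤ_[p]
  have hι : Function.Injective ι := Submodule.subtype_injective _
  have hπ' : Function.Surjective π' := hπ
  have hex : Function.Exact ι π' := LinearMap.exact_subtype_ker_map π
  -- base change to the flat `ℤ_p`-algebra `ℚ_p` (`ℚ_p`-linear maps, underlying `lTensor`)
  have hι' : Function.Injective (ι.baseChange ℚ_[p]) := by
    rw [LinearMap.baseChange_eq_ltensor]
    exact Module.Flat.lTensor_preserves_injective_linearMap ι hι
  have hπ'' : Function.Surjective (π'.baseChange ℚ_[p]) := by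
    rw [LinearMap.baseChange_eq_ltensor]
    exact LinearMap.lTensor_surjective ℚ_[p] hπ'
  have hex' : Function.Exact (ι.baseChange ℚ_[p]) (π'.baseChange ℚ_[p]) := by
    rw [LinearMap.baseChange_eq_ltensor, LinearMap.baseChange_eq_ltensor]
    exact lTensor_exact ℚ_[p] hex hπ'
  -- finite-dimensionality
  haveI : Module.Finite ℚ_[p] (ℚ_[p] ⊗[ℤ_[p]] X) := IwasawaAlgebra.finite_baseChange_of_isTorsion p hX
  haveI : Module.Finite ℚ_[p] (ℚ_[p] ⊗[ℤ_[p]] Y) := Module.Finite.of_surjective _ hπ''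
  haveI : Module.Finite ℚ_[p] (ℚ_[p] ⊗[ℤ_[p]] (LinearMap.ker π)) := Module.Finite.of_injective _ hι'
  -- dimension count
  have h1 := LinearMap.finrank_range_add_finrank_ker (π'.baseChange ℚ_[p])
  rw [LinearMap.range_eq_top.mpr hπ'', finrank_top, hex'.linearMap_ker_eq,
    LinearMap.finrank_range_of_inj hι'] at h1
  omega

end Summit.BirchSwinnertonDyer.Rank1Residual.X2.DualRestrictionInvariants

end
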